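import Summits.HodgeConjecture.CorCM.OcticWeilMultiFrameTransfer
import Summits.HodgeConjecture.CorCM.Census.OcticWeilMultiExtraction
import Summits.HodgeConjecture.CorCM.OcticCurveFourfoldWeilParts
import HarnessLib

/-!
# COR-CM — any number `r` of CM types over one octic CM field: the sub-product `B_m ⊞ E ⊞ E` of `Y⁺ = E ⊞ Y` and its six-point weights
# of constant sign — algebraic GIVEN the Weil plane of `(B_m × E) × E` (the input of the sixfold parts)

Cell `pub-hodgecm2` (COR-CM), seat b30 gen 25 (2026-08-23); count-neutral own lane OCTIC-MULTI (geometry half).  Theorems + two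
bookkeeping definitions (the re-slotting map `consSlot r` and the sub-product `foldO m`); no named fact, no `sorry`: the Weil plane of
`((B_m × E) × E, (ι(iδ) × ι(δ)) × ι(δ))` enters as the HYPOTHESIS `hW₃` (discharged downstream from `Markman2025_weilClasses_algebraic_
hyperbolicSixfold` by gen 18's `OcticCurveFourfold.weilClassesOf_le_algebraicClasses_cmFourfold_prod_cmCurve_prod_cmCurve_of_
markmanSixfold`).  The slot-generic twin of §1–§2 of gen 20's `CorCM/OcticWeilMixedSixfoldParts.lean`; the sixfold parts themselves
(re-slotting, any slot map) are the sequel `CorCM/OcticWeilMultiSixfoldParts.lean`.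

* §1 `consSlot r = (0; 0, 1, …, r)` (`Fin.cons 0 id : Fin (r+2) → Fin (r+1)`: a SECOND curve slot in front, `Y⁺ = E ⊞ Y`), `foldO m =
  (m+2, 1, 0)` (the sub-product `B_m ⊞ E ⊞ E` of `Y⁺`); `apply_eq_of_signO` — sign ⟹ eigenvalue `±i√d` on `a = (δ; iδ, …, iδ)`;
  `fst_eq_zero_of_toPtO_eq_inl`.
* §2 `weightClassesAlg_three_le_algebraicClasses_of_signO` — a six-point weight of `B_m ⊞ E ⊞ E` of constant sign lies in a Weil
  eigenline (`PairWeights.weightClassesAlg_le_weilClassesPlus/Minus`), algebraic by `hW₃` transported to `⨁`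
  (`OcticCurveFourfold.weilClassesOf_biproduct₃_le_algebraicClasses_of_prod`).
* §3 `IsSixPartO.exists_pair` / `IsSixPartO.eq_of_inr` (the two curve points; injectivity off the curve labels).
HONEST FRAMING: nothing about the Hodge conjecture is concluded here; `HC_CM` is not asserted.
[cite: Deligne1982HodgeCycles, §5 (c)] [cite: vanGeemen1994HodgeAV, 4.9] [cite: MoonenZarhin1995Duke, Thm. 2.4]

## References
* [Deligne1982HodgeCycles] P. Deligne, LNM 900 (1982), §5 (c).  [vanGeemen1994HodgeAV] B. van Geemen, LNM 1594 (1994), 3.6–3.7,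
  4.9.  [MoonenZarhin1995Duke] B. Moonen, Yu. Zarhin, Duke Math. J. 77 (1995), Thm. 2.4.
-/

noncomputable section

open CategoryTheory CategoryTheory.Limits NumberField

namespace Summit.HodgeConjecture.CorCM.OcticWeilMulti

open Literature.AlgebraicGeometry Literature.AlgebraicGeometry.Motives Literature.AlgebraicGeometry.HodgeTheory
open Literature.AlgebraicGeometry.ComplexMultiplication (IsCMTypeRealisation)
open Literature.AlgebraicGeometry.Pohlmann1968
open Literature.AlgebraicTopology.SingularHomology
open Literature.NumberTheory.ComplexMultiplication
open Summit.HodgeConjecture.CorCM.Census.OcticWeilMulti (PtO IsSixPartO)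
open Summit.HodgeConjecture.CorCM.DecicWeil23Multi (multiSlots sigma_casesM)
open Summit.HodgeConjecture.CorCM.OcticCurveFourfold (comp_eq_conjugate_of_snd_eq_false
  weilClassesOf_biproduct₃_le_algebraicClasses_of_prod)
open Summit.HodgeConjecture.CorCM.PairWeights

open scoped Classical

/-! ## §1 The re-slotting map, the sub-product, the eigenvalues -/

/-- **A second curve slot in front of `Y = E ⊞ B₁ ⊞ ⋯ ⊞ B_r`**: `consSlot r = (0; 0, 1, …, r)` as `Fin.cons`, so that `consSlot r 0` is
DEFINITIONALLY the curve slot `0` and `consSlot r l.succ` is DEFINITIONALLY `l` (`Y⁺ = E ⊞ Y = ⨁_l A(consSlot r l)`). [folklore] -/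
def consSlot (r : ℕ) : Fin (r + 2) → Fin (r + 1) := Fin.cons 0 fun l : Fin (r + 1) => l

/-- `consSlot r 0 = 0`. [folklore] -/
@[simp] theorem consSlot_zero (r : ℕ) : consSlot r 0 = 0 := rfl

/-- `consSlot r (l+1) = l`. [folklore] -/
@[simp] theorem consSlot_succ {r : ℕ} (l : Fin (r + 1)) : consSlot r l.succ = l := rfl

/-- The three-factor sub-product `(m+2, 1, 0)` of `Y⁺`: `B_m ⊞ E ⊞ E` (fourfold FIRST, as in gen 18's sixfold `(B × E) × E`). [folklore] -/
def foldO {r : ℕ} (m : Fin r) : Fin 3 → Fin (r + 2) := ![m.succ.succ, (0 : Fin (r + 1)).succ, 0]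

/-- `foldO m` is injective. [folklore] -/
theorem foldO_injective {r : ℕ} (m : Fin r) : Function.Injective (foldO m) := by
  intro a b h
  fin_cases a <;> fin_cases b
  · rfl
  · change m.succ.succ = (0 : Fin (r + 1)).succ at h
    exact absurd (Fin.succ_injective _ h) (Fin.succ_ne_zero m)
  · change m.succ.succ = (0 : Fin (r + 2)) at h
    exact absurd h (Fin.succ_ne_zero _)
  · change (0 : Fin (r + 1)).succ = m.succ.succ at h
    exact absurd (Fin.succ_injective _ h).symm (Fin.succ_ne_zero m)
  · rfl
  · change (0 : Fin (r + 1)).succ = (0 : Fin (r + 2)) at h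
    exact absurd h (Fin.succ_ne_zero _)
  · change (0 : Fin (r + 2)) = m.succ.succ at h
    exact absurd h.symm (Fin.succ_ne_zero _)
  · change (0 : Fin (r + 2)) = (0 : Fin (r + 1)).succ at h
    exact absurd h.symm (Fin.succ_ne_zero _)
  · rfl

/-- The range of `foldO m` is `{m+2, 1, 0}`. [folklore] -/
theorem mem_range_foldO {r : ℕ} {m : Fin r} {l : Fin (r + 2)} (h : l = m.succ.succ ∨ l = (0 : Fin (r + 1)).succ ∨ l = 0) :
    l ∈ Set.range (foldO m) := by
  rcases h with rfl | rfl | rfl; exacts [⟨0, rfl⟩, ⟨1, rfl⟩, ⟨2, rfl⟩]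

section Sixfold

variable {I : Type} {r : ℕ} {Kf : I → Type} [∀ i, Field (Kf i)] [∀ i, NumberField (Kf i)]
  {i₀ i₁ : I} {e : (Kf i₁ →+* ℂ) ≃ Fin 4 × Bool} {τ : Kf i₀ →+* ℂ} {i : Kf i₀ →+* Kf i₁}
  (hk : ∀ σ : Kf i₀ →+* ℂ, σ = τ ∨ σ = ComplexEmbedding.conjugate τ)
  (he_sign : ∀ s : Kf i₁ →+* ℂ, (e s).2 = true ↔ s.comp i = τ)
  {A : Fin (r + 1) → AbelianVariety ℂ} {Φ : ∀ j : Fin (r + 1), CMType (Kf (multiSlots r i₀ i₁ j))}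
  {ι : ∀ j, 𝓞 (Kf (multiSlots r i₀ i₁ j)) →+* End (A j)}
  {θ : ∀ j, Kf (multiSlots r i₀ i₁ j) →+* Module.End ℂ (complexBetti (A j).X 1)}
  (hA : ∀ j, IsCMTypeRealisation (Φ j) (A j) (ι j) (θ j))
  {δ : 𝓞 (Kf i₀)} {d : ℕ} (hτ : τ (δ : Kf i₀) = Complex.I * (Real.sqrt d : ℂ))

omit [∀ i, NumberField (Kf i)] in
include hk he_sign hτ in
/-- **Sign ⟹ eigenvalue**: a point of the index set of `Y = E ⊞ B₁ ⊞ ⋯ ⊞ B_r` of sign `b` — over `inl b`, or over a label `(m, a, b)` —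
has eigenvalue `+i√d` (`b = true`) resp. `−i√d` (`b = false`) on the family `a = (δ; iδ, …, iδ)`. [cite: Deligne1982HodgeCycles, §5 (c)] -/
theorem apply_eq_of_signO (x : (l : Fin (r + 1)) × (Kf (multiSlots r i₀ i₁ l) →+* ℂ)) (b : Bool)
    (hx : toPtO e τ x = Sum.inl b ∨ ∃ (m : Fin r) (a : Fin 4), toPtO e τ x = Sum.inr (m, (a, b))) :
    x.2 (((Fin.cons δ (fun _ : Fin r => RingOfIntegers.mapRingHom i δ) :
        ∀ l : Fin (r + 1), 𝓞 (Kf (multiSlots r i₀ i₁ l))) x.1 : 𝓞 (Kf (multiSlots r i₀ i₁ x.1))) : Kf (multiSlots r i₀ i₁ x.1)) =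
      if b then Complex.I * (Real.sqrt d : ℂ) else -(Complex.I * (Real.sqrt d : ℂ)) := by
  have hconjτ : ComplexEmbedding.conjugate τ (δ : Kf i₀) = -(Complex.I * (Real.sqrt d : ℂ)) := by
    rw [ComplexEmbedding.conjugate_coe_eq, hτ, map_mul, Complex.conj_I, Complex.conj_ofReal, neg_mul]
  rcases sigma_casesM x with ⟨σ, rfl⟩ | ⟨m, s, rfl⟩
  · -- the curve slot: `σ = τ_b`
    have hσ : decide (σ = τ) = b := by
      rcases hx with h | ⟨m, a, h⟩
      · rw [toPtO_zero, Sum.inl.injEq] at h; exact h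
      · rw [toPtO_zero] at h; exact absurd h Sum.inl_ne_inr
    show σ (δ : Kf i₀) = _
    cases b
    · rw [if_neg Bool.false_ne_true, (hk σ).resolve_left (of_decide_eq_false hσ)]
      exact hconjτ
    · rw [if_pos rfl, of_decide_eq_true hσ]
      exact hτ
  · -- a fourfold slot: `(e s).2 = b`
    have hs : (e s).2 = b := by
      rcases hx with h | ⟨m', a, h⟩
      · rw [toPtO_succ] at h; exact absurd h Sum.inr_ne_inl
      · rw [toPtO_succ, Sum.inr.injEq, Prod.mk.injEq] at h
        rw [h.2]
    show s ((RingOfIntegers.mapRingHom i δ : 𝓞 (Kf i₁)) : Kf i₁) = _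
    have hmap : ((RingOfIntegers.mapRingHom i δ : 𝓞 (Kf i₁)) : Kf i₁) = i (δ : Kf i₀) := rfl
    rw [hmap]
    change (s.comp i) (δ : Kf i₀) = _
    cases b
    · rw [if_neg Bool.false_ne_true, comp_eq_conjugate_of_snd_eq_false hk he_sign hs]
      exact hconjτ
    · rw [if_pos rfl, (he_sign s).1 hs]
      exact hτ

/-! ## §2 A six-point weight of `B_m ⊞ E ⊞ E` of constant sign is algebraic, given the Weil plane -/

omit [∀ i, NumberField (Kf i)] in
include hk he_sign hτ in
/-- **A six-point weight of `Y₃ = B_m ⊞ E ⊞ E` (the sub-product `foldO m` of `Y⁺`) of constant sign has an algebraic line, GIVEN the Weil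
plane of the sixfold.**  All six points have eigenvalue `±i√d` on `(iδ, δ, δ)`, so the line lies in a Weil eigenline
(`PairWeights.weightClassesAlg_le_weilClassesPlus/Minus`) `⊆ W ⊗ ℂ`, algebraic by `hW₃` transported to `⨁`.
[cite: vanGeemen1994HodgeAV, 4.9] [cite: Deligne1982HodgeCycles, §5 (c)] -/
theorem weightClassesAlg_three_le_algebraicClasses_of_signO (m : Fin r)
    (hW₃ : weilClassesOf (((A m.succ).prod (A 0)).prod (A 0))
      (AbelianVariety.prodLift
        (AbelianVariety.fst ((A m.succ).prod (A 0)) (A 0) ≫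
          AbelianVariety.prodLift (AbelianVariety.fst (A m.succ) (A 0) ≫ ι m.succ (RingOfIntegers.mapRingHom i δ))
            (AbelianVariety.snd (A m.succ) (A 0) ≫ ι 0 δ))
        (AbelianVariety.snd ((A m.succ).prod (A 0)) (A 0) ≫ ι 0 δ)) 3 d ≤
      algebraicClasses (((A m.succ).prod (A 0)).prod (A 0)).X 3)
    (b : Bool) (T : Finset ((l : Fin 3) × (Kf (multiSlots r i₀ i₁ (consSlot r (foldO m l))) →+* ℂ))) (hTcard : T.card = 2 * 3)
    (hsgn : ∀ z ∈ T, toPtO e τ ⟨consSlot r (foldO m z.1), z.2⟩ = Sum.inl b ∨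
      ∃ (m' : Fin r) (a : Fin 4), toPtO e τ ⟨consSlot r (foldO m z.1), z.2⟩ = Sum.inr (m', (a, b))) :
    weightClassesAlg (fun l => A (consSlot r (foldO m l))) (fun l => ι (consSlot r (foldO m l))) (2 * 3) T ≤
      algebraicClasses (⨁ fun l => A (consSlot r (foldO m l))).X 3 := by
  -- the family `(iδ, δ, δ)` on the three slots, as the restriction of `a = (δ; iδ, …, iδ)`
  let aY : ∀ l : Fin (r + 1), 𝓞 (Kf (multiSlots r i₀ i₁ l)) := Fin.cons δ fun _ : Fin r => RingOfIntegers.mapRingHom i δ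
  let a₃ : ∀ l : Fin 3, 𝓞 (Kf (multiSlots r i₀ i₁ (consSlot r (foldO m l)))) := fun l => aY (consSlot r (foldO m l))
  have hval : ∀ z ∈ T, z.2 ((a₃ z.1 : 𝓞 (Kf (multiSlots r i₀ i₁ (consSlot r (foldO m z.1))))) :
      Kf (multiSlots r i₀ i₁ (consSlot r (foldO m z.1)))) = if b then Complex.I * (Real.sqrt d : ℂ) else -(Complex.I * (Real.sqrt d : ℂ)) :=
    fun z hz => apply_eq_of_signO hk he_sign hτ ⟨consSlot r (foldO m z.1), z.2⟩ b (hsgn z hz)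
  -- the Weil plane of `⨁_l A(consSlot r (foldO m l))`, algebraic by `hW₃`
  have hWeil : weilClassesOf (⨁ fun l => A (consSlot r (foldO m l))) (biproduct.map fun l => ι (consSlot r (foldO m l)) (a₃ l)) 3 d ≤
      algebraicClasses (⨁ fun l => A (consSlot r (foldO m l))).X 3 :=
    weilClassesOf_biproduct₃_le_algebraicClasses_of_prod (A := fun l => A (consSlot r (foldO m l)))
      (fun l => ι (consSlot r (foldO m l)) (a₃ l)) hW₃
  cases b
  · refine (weightClassesAlg_le_weilClassesMinus (K := fun l => Kf (multiSlots r i₀ i₁ (consSlot r (foldO m l))))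
      (A := fun l => A (consSlot r (foldO m l))) (ι := fun l => ι (consSlot r (foldO m l))) a₃ hTcard fun z hz => ?_).trans
      ((weilClassesMinus_le_weilClassesOf _ _ 3 d).trans hWeil)
    simpa using hval z hz
  · refine (weightClassesAlg_le_weilClassesPlus (K := fun l => Kf (multiSlots r i₀ i₁ (consSlot r (foldO m l))))
      (A := fun l => A (consSlot r (foldO m l))) (ι := fun l => ι (consSlot r (foldO m l))) a₃ hTcard fun z hz => ?_).trans
      ((weilClassesPlus_le_weilClassesOf _ _ 3 d).trans hWeil)
    simpa using hval z hz

omit [∀ i, NumberField (Kf i)] in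
include hk in
/-- A curve point of the index set: `toPtO x = inl b` forces slot `0` and the embedding `τ_b`. [folklore] -/
theorem fst_eq_zero_of_toPtO_eq_inl {x : (l : Fin (r + 1)) × (Kf (multiSlots r i₀ i₁ l) →+* ℂ)} {b : Bool}
    (hx : toPtO e τ x = Sum.inl b) :
    ∃ σ : Kf i₀ →+* ℂ, x = ⟨0, σ⟩ ∧ σ = if b then τ else ComplexEmbedding.conjugate τ := by
  rcases sigma_casesM x with ⟨σ, rfl⟩ | ⟨m, s, rfl⟩
  · refine ⟨σ, rfl, ?_⟩
    rw [toPtO_zero, Sum.inl.injEq] at hx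
    cases b
    · rw [if_neg Bool.false_ne_true]; exact (hk σ).resolve_left (of_decide_eq_false hx)
    · rw [if_pos rfl]; exact of_decide_eq_true hx
  · rw [toPtO_succ] at hx; exact absurd hx Sum.inr_ne_inl

/-! ## §3 The two curve points of a sixfold part; injectivity off the curve labels -/

omit [∀ i, NumberField (Kf i)] in
/-- A sixfold part has two distinct curve points. [folklore] -/
theorem _root_.Summit.HodgeConjecture.CorCM.Census.OcticWeilMulti.IsSixPartO.exists_pair {α : Type*} {v : α → PtO r} {m : Fin r}
    {b : Bool} {G : Finset α} (hG : IsSixPartO v m b G) :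
    ∃ x₁ ∈ G, ∃ x₂ ∈ G, x₁ ≠ x₂ ∧ v x₁ = Sum.inl b ∧ v x₂ = Sum.inl b := by
  obtain ⟨x₁, x₂, hne, h12⟩ := Finset.card_eq_two.1 hG.2.1
  have h1 : x₁ ∈ G.filter fun x => v x = Sum.inl b := by rw [h12]; simp
  have h2 : x₂ ∈ G.filter fun x => v x = Sum.inl b := by rw [h12]; simp
  exact ⟨x₁, (Finset.mem_filter.1 h1).1, x₂, (Finset.mem_filter.1 h2).1, hne, (Finset.mem_filter.1 h1).2,
    (Finset.mem_filter.1 h2).2⟩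

omit [∀ i, NumberField (Kf i)] in
/-- In a sixfold part, two points over the same fourfold label coincide. [folklore] -/
theorem _root_.Summit.HodgeConjecture.CorCM.Census.OcticWeilMulti.IsSixPartO.eq_of_inr {α : Type*} {v : α → PtO r} {m : Fin r}
    {b : Bool} {G : Finset α} (hG : IsSixPartO v m b G) {x x' : α} (hx : x ∈ G) (hx' : x' ∈ G)
    {q : Fin r × (Fin 4 × Bool)} (hq : v x = Sum.inr q) (hq' : v x' = Sum.inr q) : x = x' := by
  obtain ⟨a, ha⟩ : ∃ a : Fin 4, v x = Sum.inr (m, (a, b)) := by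
    rcases hG.mem_cases hx with h | h
    · rw [hq] at h; exact absurd h Sum.inr_ne_inl
    · exact h
  have hqa : q = (m, (a, b)) := by rw [hq] at ha; exact Sum.inr.inj ha
  subst hqa
  obtain ⟨z, hz⟩ := Finset.card_eq_one.1 (hG.2.2 a)
  have hxz : x ∈ G.filter fun x => v x = Sum.inr (m, (a, b)) := Finset.mem_filter.2 ⟨hx, hq⟩
  have hx'z : x' ∈ G.filter fun x => v x = Sum.inr (m, (a, b)) := Finset.mem_filter.2 ⟨hx', hq'⟩
  rw [hz, Finset.mem_singleton] at hxz hx'z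
  rw [hxz, hx'z]

end Sixfold

end Summit.HodgeConjecture.CorCM.OcticWeilMulti

end
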